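import Summits.BirchSwinnertonDyer.Rank1Residual.X2.HidaLimitRoadIntOther
import Summits.BirchSwinnertonDyer.BirchSwinnertonDyer.Theorems.EisensteinPrimesBSDpOnCellCStubC3RoadHFromControl
import Summits.BirchSwinnertonDyer.BirchSwinnertonDyer.Theorems.EisensteinPrimesBSDpOnCellCCtlSplitClass
import Summits.BirchSwinnertonDyer.BirchSwinnertonDyer.Theorems.EisensteinPrimesHidaLimitFittingBound
import Summits.BirchSwinnertonDyer.Rank1Residual.X11b.LocalPrimaryCohomologyEP
import Literature.NumberTheory.GaloisRepresentations.NumberFieldCdTwoProofs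
import Literature.NumberTheory.EllipticCurves.AnticyclotomicPrimeDecompositionSplitProofs
import HarnessLib

/-!
# Crux 4 `BSDpOnCellC` (stmt-BirchSwinnertonDyer-19034), line b1 v9, stub `stub_c3` (RE-ORIENTED, RULING
# L31/L32): ROAD H'S KERNEL RESIDUAL IN THE FAITHFUL ORIENTATION — `stub_c3` (v9) from FOUR PUBLISHED
# facts + the reverse divisibility `Fitt_Λ(X_ac^∅ STRICT AT 𝔭̄)·𝓞_{ℂ_p}⟦T⟧ ⊆ (Q)` at every frame at
# `(ι′, 𝔭)` + Keller–Yin D′ at `𝔭̄`; the `Λ`-torsion of `X_ac^∅` at `𝔭̄` DISCHARGED at both signs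
# (cell `bsd-eis`, seat `bsd-eis-c3h` g4; the re-oriented twin of seat g0's p459435 / p463269)

HONEST FRAMING (cell `bsd-eis`, run/shared/lean/pub/bsd-eis/): theorems only; nothing booked; X2 stays
CONSTRUCTION-SHAPED; no label or count moves; BSD is not proved by any of this. CONDITIONAL on four
PUBLISHED facts (conjuncts of `stub_publishedFacts`: Gross–Zagier–Kolyvagin, modularity, Poitou–Tate ×2),
on the REVERSE DIVISIBILITY in Fitting form at every X2c Heegner datum and every `𝓞_{ℂ_p}`-frame `Q` at
`(ι′, 𝔭)` for `X_ac^∅` STRICT AT `𝔭̄` (hypothesis-shaped, stated inline — what road H, Keller–Yin §5.1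
[PRE] + bsd-eis-ky MEMO-2 / cgshw MEMO-8/9, is meant to DELIVER; not in refereed print at a residually
reducible `p ‖ N`), and on KY D′ at `𝔭̄` [PRE] (`X2.Nonsplit/SplitMuLambdaOnTreeIntOther`, p489067).

## What

Seat g0 showed (p459435 `hidaLimitInputsIntAt_of_isTorsion_of_map_fittingIdeal_le`, p463269
`stub_c3_of_fittingRevDivInt_of_splitControl_of_muLambdaInt`) that the kernel content of road H's
typed inputs is [`X_ac^∅` `Λ`-torsion ∧ `(Fitt_Λ X_ac^∅)♭ ⊆ (Q)`], the finite-submodule bound of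
Keller–Yin Lemma 5.1.2 being the kernel theorem `exists_span_C_pow_mul_span_le_fittingIdeal_zero`
(p458031) — all with the X-slot at the frame's own prime `𝔭` (the conjugate orientation, RULING L31/L33).
This file is the faithful-orientation twin, on the p489067 predicates, with two improvements that the
tree has earned since g0: the torsion input is discharged at BOTH signs from PUBLISHED facts (non-split:
control theorem p398508 read AT THE OTHER DEGREE-ONE PRIME, `X11b.degreeOne_of_splitsIn`; split: k5-c4's
class-wide `CtlLoc.splitControlOnTree_of_cellC`, p484252 — no CTL-split hypothesis), and `cd ≤ 2`,
Euler–Poincaré, Brink are fed BY NAME as tree theorems (v8.1/v9 shrink of `stub_publishedFacts`):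

* §1 `C_pow_mul_map_mem_span_of_isTorsion_of_map_fittingIdeal_le` — pure `Λ`-algebra: torsion +
  `Ch = (F)` + `(Fitt₀)♭ ⊆ (Q)` ⟹ `∃ a, p^a·F♭ ∈ (Q)` (KY Lemma 5.1.2 in the kernel, read in `𝓞_{ℂ_p}⟦T⟧`).
* §2 `hidaLimitRevDivOnTreeIntOther_of_isTorsion_of_map_fittingIdeal_le` — the honesty lemma at `𝔭̄`:
  `X2.HidaLimitRevDivOnTreeIntOther W p` ⟸ [torsion ∧ Fitting-form reverse divisibility] at every datum.
* §3 `isTorsion_xAc_other_of_cellC` — `X_ac^∅(E[p^∞])` STRICT AT `𝔭̄` is `Λ`-torsion at every X2c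
  datum, EITHER sign, from the four PUB facts.
* §4 `hidaLimitRevDivOnTreeIntOther_of_map_fittingIdeal_le` — road H's re-oriented output from the four
  PUB facts + the Fitting-form reverse divisibility alone.
* §5 **`stub_c3_of_fittingRevDivIntOther_of_muLambdaIntOther`** — the v9 `stub_c3` signature VERBATIM
  (both conjuncts on `X2.Nonsplit/SplitIMCEqOnTreeIntOther`) from [PUB ×4] + [Fitting-form reverse
  divisibility at `𝔭̄`, class-wide] + [D′ at `𝔭̄`, each sign].

So, for the census of line b1 v9: modulo PUBLISHED facts and KY D′, the IMC stub over the wide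
receptacle is EXACTLY the one-sided reverse divisibility "`Fitt_Λ(X_ac^∅ strict at 𝔭̄)·𝓞_{ℂ_p}⟦T⟧ ⊆
(Q)` for every `𝓞_{ℂ_p}`-frame `Q` at `(ι′, 𝔭)`" — in print's terms (littype-05 C4 verdict, RULING
L31/L33) the Skinner–Urban direction `Char(𝔛_f)Λ^nr ⊆ (𝓛_f)` of Keller–Yin Thm. 5.1.3 for KY's own
`𝔛_f`, which road H (KY §5.1 (a)–(e) + (α)) or road R-β's partner must supply. What this is NOT: not a
proof of that divisibility or of D′; `stub_c3` stays CLOSED BY NAME at the PRE tier by p481783/p487050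
regardless of this file.

References: [KellerYin2024] §5.1 (a)–(e), Lemma 5.1.2, Thm. 5.1.3 = Thm. D (arXiv:2402.12781v2, PRE);
[Castella2018] Thm. 2.3; [JetchevSkinnerWan2017] Thm. 3.3.1; [SkinnerUrban2014] §3.1.6;
[Skinner2016PacificMC] §3.1; [Washington1997] §13.2; cell memos cgshw MEMO-8/9, bsd-eis-ky MEMO-2,
c3h MEMO-1/2, k5-c4 MEMO-3.
-/

set_option autoImplicit false
set_option linter.dupNamespace false -- the summit namespace `…BirchSwinnertonDyer.BirchSwinnertonDyer.Theorems` (Sub = Summit, D-0017) trips it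

noncomputable section

open scoped Classical MatrixGroups ModularForm

open CongruenceSubgroup WeierstrassCurve NumberField IsDedekindDomain Field PowerSeries
  Literature.RingTheory.FittingIdeal
  Literature.NumberTheory.EllipticCurves Literature.NumberTheory.EllipticCurves.GreenbergSelmer
  Literature.NumberTheory.EllipticCurves.ModularForms
  Literature.NumberTheory.EllipticCurves.Rank1Residual
  Literature.NumberTheory.EllipticCurves.Rank1Residual.Typed
  Literature.NumberTheory.GaloisRepresentations Literature.NumberTheory.GaloisCohomology
  Literature.NumberTheory.Automorphic
  Summit.BirchSwinnertonDyer.Rank1Residual.X11b.AcSelmer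
  Summit.BirchSwinnertonDyer.Rank1Residual.X11b.Halves
  Summit.BirchSwinnertonDyer.Rank1Residual.X11b
  Summit.BirchSwinnertonDyer.Rank1Residual.X2

namespace Summit.BirchSwinnertonDyer.BirchSwinnertonDyer.Theorems

/-! ### §1 Keller–Yin Lemma 5.1.2 read in `𝓞_{ℂ_p}⟦T⟧`: torsion + Fitting-form divisibility ⟹ `p^a·F♭ ∈ (Q)` -/

section Algebra

variable {p : ℕ} [Fact p.Prime]

/-- **Torsion + `(Fitt₀)♭ ⊆ (Q)` ⟹ `∃ a, p^a · F♭ ∈ (Q)` for a generator `F` of the characteristic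
ideal.** For a finitely generated torsion `Λ = ℤ_p⟦T⟧`-module `X` with `Ch_Λ(X) = (F)`, the kernel form
of Keller–Yin Lemma 5.1.2 (`exists_span_C_pow_mul_span_le_fittingIdeal_zero`, p458031: `(p)^a·(F) ⊆
Fitt₀(X)` with `p^a` killing the maximal finite submodule) and a one-sided bound
`Fitt₀(X)·𝓞_{ℂ_p}⟦T⟧ ⊆ (Q)` give `p^a·F♭ ∈ (Q)` in `𝓞_{ℂ_p}⟦T⟧` (`F♭` = `F` read through
`ℤ_p → 𝓞_{ℂ_p}`). Pure algebra; nothing about any curve.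
[cite: KellerYin2024, Lemma 5.1.2 (arXiv:2402.12781v2)] [cite: Washington1997, §13.2] -/
theorem C_pow_mul_map_mem_span_of_isTorsion_of_map_fittingIdeal_le {X : Type*} [AddCommGroup X]
    [Module (IwasawaAlgebra p) X] [Module.Finite (IwasawaAlgebra p) X]
    (hX : Module.IsTorsion (IwasawaAlgebra p) X) {F : IwasawaAlgebra p}
    (hF : Module.charIdeal (IwasawaAlgebra p) X = Ideal.span {F}) {Q : PowerSeries 𝓞_ℂ_[p]}
    (hle : (Module.fittingIdeal (IwasawaAlgebra p) X 0).map (PowerSeries.map (R1.toCpInt p)) ≤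
      Ideal.span {Q}) :
    ∃ a : ℕ, PowerSeries.C ((p : 𝓞_ℂ_[p]) ^ a) * PowerSeries.map (R1.toCpInt p) F ∈
      Ideal.span ({Q} : Set (PowerSeries 𝓞_ℂ_[p])) := by
  obtain ⟨a, ha⟩ := exists_span_C_pow_mul_span_le_fittingIdeal_zero (p := p) X hX hF
  refine ⟨a, hle ?_⟩
  have hmem : (C (p : ℤ_[p]) : IwasawaAlgebra p) ^ a * F ∈
      Module.fittingIdeal (IwasawaAlgebra p) X 0 := by
    refine ha ?_
    rw [Ideal.span_singleton_pow]
    exact Ideal.mul_mem_mul (Ideal.mem_span_singleton_self _) (Ideal.mem_span_singleton_self _)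
  have h2 := Ideal.mem_map_of_mem (PowerSeries.map (R1.toCpInt p)) hmem
  rwa [map_mul, map_pow, PowerSeries.map_C, map_natCast, ← map_pow] at h2

end Algebra

/-! ### §2 The honesty lemma at `𝔭̄`: road H's re-oriented output ⟸ [torsion ∧ Fitting-form divisibility] -/

section TorsionForm

variable {W : WeierstrassCurve ℚ} [W.IsElliptic] [W.IsGloballyMinimal] {p : ℕ} [Fact p.Prime]

omit [W.IsGloballyMinimal] in
/-- **`X2.HidaLimitRevDivOnTreeIntOther W p` from [torsion] ∧ [`(Fitt_Λ X_ac^∅ strict at 𝔭̄)♭ ⊆ (Q)`].**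
On the binders of `X2.HidaLimitRevDivOnTreeIntOther W p` (X2c Heegner datum with `D_K` odd and `(p)`
split, anticyclotomic `κ`/`γ`, degree-one `𝔭 ∋ p`, the other prime `𝔭̄`, newform, embedding datum
inducing `𝔭`, `𝓞_{ℂ_p}`-frame `(Ω_K, Ω_p, Q)` at `(ι′, 𝔭)`): IF `X_ac^∅(E[p^∞])` STRICT AT `𝔭̄` is
`Λ`-torsion and `Fitt_Λ(X_ac^∅ strict at 𝔭̄)·𝓞_{ℂ_p}⟦T⟧ ⊆ (Q)`, THEN `∃ a, p^a·𝓕♭ ∈ (Q)` for every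
generator `𝓕` of `Ch_Λ` (§1; `X_ac^∅` f.g. by `XAc.module_finite_empty`). So the kernel content of road H's
re-oriented output is the reverse divisibility in Fitting form; its Hida-theoretic provenance lives in
the docstrings, not in the type. The hypothesis is stated INLINE (no new `Prop`). CONDITIONAL; nothing
booked. [folklore] [cite: KellerYin2024, §5.1 (a)–(e) and Lemma 5.1.2 (arXiv:2402.12781v2) (shape only)] -/
theorem hidaLimitRevDivOnTreeIntOther_of_isTorsion_of_map_fittingIdeal_le
    (h : ∀ (N : ℕ) [NeZero N] (K : Type) [Field K] [NumberField K] (Dt : ModularParametrizationData W N)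
      (H : HeegnerDatum N (NumberField.discr K)) (ιK : K →+* ℂ) (P : (W.baseChange K).toAffine.Point),
      CellC W p → W.conductorNorm ℤ = N →
      IsImaginaryQuadratic K → NumberField.discr K < -4 → SatisfiesHeegnerHypothesis N K →
      (W.quadraticTwist (NumberField.discr K : ℚ)).entireLFunction 1 ≠ 0 →
      WeierstrassCurve.Affine.Point.map ιK.toRatAlgHom P = heegnerPointComplex Dt H →
      ¬ (p : ℤ) ∣ Dt.c → ¬ IsOfFinAddOrder P →
      Odd (NumberField.discr K) →
      ∀ (κ : ZpExtension K p), κ.IsAnticyclotomic →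
        ∀ (γ : Field.absoluteGaloisGroup K) [Fact (κ.IsTopGenerator γ)]
          (𝔭 : HeightOneSpectrum (𝓞 K)), ((p : ℕ) : 𝓞 K) ∈ 𝔭.asIdeal →
          𝔭.asIdeal.ramificationIdx (𝓞 ℚ) = 1 → 𝔭.asIdeal.inertiaDeg (𝓞 ℚ) = 1 →
          ∀ (𝔭bar : HeightOneSpectrum (𝓞 K)), ((p : ℕ) : 𝓞 K) ∈ 𝔭bar.asIdeal → 𝔭bar ≠ 𝔭 →
            ((Ideal.span {(p : ℤ)}).primesOver (𝓞 K)).ncard = 2 →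
          ∀ (f : CuspForm (CongruenceSubgroup.Gamma0 N) 2), IsNewformOf W f →
            ∀ (ι' : PadicAlgCl p ≃+* ℂ),
              (∀ (w : InfinitePlace K) (k : 𝓞 K),
                k ∈ 𝔭.asIdeal ↔ ‖ι'.symm (w.embedding (k : K))‖ < 1) →
              ∀ (ΩK : ℂ) (Ωp : ℂ_[p]) (Q : PowerSeries 𝓞_ℂ_[p]), ΩK ≠ 0 → ‖Ωp‖ = 1 →
                R1.IsBDPLFunctionInt p ι' 𝔭 κ γ f ΩK Ωp Q →
                  Module.IsTorsion (IwasawaAlgebra p) (XAc (W.baseChange K) p κ 𝔭bar ∅ γ) ∧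
                  (Module.fittingIdeal (IwasawaAlgebra p) (XAc (W.baseChange K) p κ 𝔭bar ∅ γ) 0).map
                      (PowerSeries.map (R1.toCpInt p)) ≤ Ideal.span {Q}) :
    HidaLimitRevDivOnTreeIntOther W p := by
  intro N _ K _ _ Dt H ιK P hc hN hK hd4 hHN hLt hP hcM hPinf hodd κ hκ γ _ 𝔭 h𝔭 he hf 𝔭bar h𝔭bar hne
    hsplit f hfW ι' hι' ΩK Ωp Q hΩK hΩp hQ F hchar
  obtain ⟨htor, hle⟩ := h N K Dt H ιK P hc hN hK hd4 hHN hLt hP hcM hPinf hodd κ hκ γ 𝔭 h𝔭 he hf 𝔭bar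
    h𝔭bar hne hsplit f hfW ι' hι' ΩK Ωp Q hΩK hΩp hQ
  haveI : Module.Finite (IwasawaAlgebra p) (XAc (W.baseChange K) p κ 𝔭bar ∅ γ) :=
    XAc.module_finite_empty κ 𝔭bar γ
  exact C_pow_mul_map_mem_span_of_isTorsion_of_map_fittingIdeal_le htor hchar hle

end TorsionForm

/-! ### §3 `X_ac^∅` STRICT AT `𝔭̄` is `Λ`-torsion at every X2c datum, either sign, from PUBLISHED facts -/

section TorsionOther

variable {W : WeierstrassCurve ℚ} [W.IsElliptic] [W.IsGloballyMinimal] {p : ℕ} [Fact p.Prime]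

/-- **`X_ac^∅(E[p^∞])` STRICT AT THE OTHER PRIME `𝔭̄` is `Λ`-torsion at an X2c datum, EITHER SIGN, FROM
PUBLISHED FACTS.** For a CellC pair `(E, p)`, `K` imaginary quadratic in which `p` splits,
`L(E^{d_K},1) ≠ 0`, a non-torsion `P ∈ E(K)`, anticyclotomic `κ` with generator `γ`, and ANY prime
`𝔭̄ ∋ p` of `𝓞_K`: `𝔭̄` has degree one (`X11b.degreeOne_of_splitsIn`, the fundamental identity in a
quadratic field), so the tree's control theorems apply AT `𝔭̄`: at a non-split `p`
`isTorsion_xAc_of_cellC_of_not_split` (p398508 in CellC currency; inputs GZK, modularity, Poitou–Tate ×2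
by name as hypotheses, and `cd ≤ 2` / Euler–Poincaré / Brink as the tree theorems
`fieldCdLE_two_of_numberField_holds` / `X11b.LocBridge.localEulerPoincareCharacteristic_adicCompletionEP` /
`ZpExtension.decomp_not_le_kerSubgroup_of_isAnticyclotomic_holds`), at a split `p` k5-c4's class-wide
`CtlLoc.splitControlOnTree_of_cellC` (p484252, any local/global `p`-torsion) through
`isTorsion_xAc_of_splitControlOnTree`. CONDITIONAL on the four cited facts; nothing booked.
[cite: Castella2018, Thm. 2.3 (arXiv:1704.06608 p. 5), first clause]
[cite: JetchevSkinnerWan2017, Thm. 3.3.1 (arXiv:1512.06894 p. 14 = CJM p. 386)] -/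
theorem isTorsion_xAc_other_of_cellC
    (hGZK : rank_eq_analyticRank_of_analyticRank_le_one) (hnf : exists_isNewformOf)
    (hPT : ∀ (K : Type) [Field K] [NumberField K], poitouTate_selmerStructure_duality K)
    (hPT2 : ∀ (K : Type) [Field K] [NumberField K], poitouTate_sha_tateDual K)
    (hc : CellC W p) {K : Type} [Field K] [NumberField K] (hK : IsImaginaryQuadratic K)
    (hsplitK : SatisfiesHeegnerHypothesis p K)
    (hLt : (W.quadraticTwist (NumberField.discr K : ℚ)).entireLFunction 1 ≠ 0)
    (P : (W.baseChange K).toAffine.Point) (hPinf : ¬ IsOfFinAddOrder P)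
    (κ : ZpExtension K p) (hκ : κ.IsAnticyclotomic) (γ : absoluteGaloisGroup K)
    [Fact (κ.IsTopGenerator γ)] (𝔭bar : HeightOneSpectrum (𝓞 K))
    (h𝔭bar : ((p : ℕ) : 𝓞 K) ∈ 𝔭bar.asIdeal) :
    Module.IsTorsion (IwasawaAlgebra p) (XAc (W.baseChange K) p κ 𝔭bar ∅ γ) := by
  have hEP : ∀ (K : Type) [Field K] [NumberField K] (v : HeightOneSpectrum (𝓞 K)),
      localEulerPoincareCharacteristic (v.adicCompletion K) :=
    fun K _ _ v ↦
      Summit.BirchSwinnertonDyer.Rank1Residual.X11b.LocBridge.localEulerPoincareCharacteristic_adicCompletionEP K v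
  have hcd : fieldCdLE_two_of_numberField :=
    Literature.NumberTheory.GaloisRepresentations.fieldCdLE_two_of_numberField_holds
  have hBr : ∀ (K : Type) [Field K] [NumberField K] (p : ℕ) [Fact p.Prime],
      ZpExtension.decomp_not_le_kerSubgroup_of_isAnticyclotomic K p :=
    fun K _ _ p _ ↦ ZpExtension.decomp_not_le_kerSubgroup_of_isAnticyclotomic_holds (K := K) (p := p)
  obtain ⟨he, hf⟩ := Summit.BirchSwinnertonDyer.Rank1Residual.X11b.degreeOne_of_splitsIn (K := K) (p := p)
    hK.1 (hsplitK p Fact.out dvd_rfl)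
    h𝔭bar
  by_cases hs : W.HasSplitMultiplicativeReductionAtPrime p
  · exact isTorsion_xAc_of_splitControlOnTree
      (CtlLoc.splitControlOnTree_of_cellC W p hGZK hnf hPT hPT2 hEP hBr hc hs) hc hs hK hsplitK hLt P
      hPinf κ hκ γ 𝔭bar h𝔭bar he hf
  · exact isTorsion_xAc_of_cellC_of_not_split hGZK hnf hPT hPT2 hEP hcd hBr hc hs hK hsplitK hLt P
      hPinf κ hκ γ 𝔭bar h𝔭bar he hf

end TorsionOther

/-! ### §4 Road H's re-oriented output from PUB facts + the Fitting-form reverse divisibility alone -/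

section RevDivOther

variable {W : WeierstrassCurve ℚ} [W.IsElliptic] [W.IsGloballyMinimal] {p : ℕ} [Fact p.Prime]

/-- **`X2.HidaLimitRevDivOnTreeIntOther W p` FROM [PUB ×4] + [`(Fitt_Λ X_ac^∅ strict at 𝔭̄)♭ ⊆ (Q)` at
every X2c Heegner datum and every `𝓞_{ℂ_p}`-frame at `(ι′, 𝔭)`].** The torsion clause of §2 is
DISCHARGED by §3 (`p ∣ N` from `Mult`, so the Heegner hypothesis for `N` makes `p` split and every
`𝔭̄ ∋ p` degree one). `hfitt` is stated INLINE on the binders of `X2.HidaLimitRevDivOnTreeIntOther` (no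
new `Prop`). CONDITIONAL-RESULT; nothing booked. [claim: KellerYin2024, status: under-review]
[cite: KellerYin2024, §5.1 (a)–(e), Lemma 5.1.2 (arXiv:2402.12781v2)] [cite: Castella2018, Thm. 2.3 (arXiv:1704.06608 p. 5)] -/
theorem hidaLimitRevDivOnTreeIntOther_of_map_fittingIdeal_le
    (hGZK : rank_eq_analyticRank_of_analyticRank_le_one) (hnf : exists_isNewformOf)
    (hPT : ∀ (K : Type) [Field K] [NumberField K], poitouTate_selmerStructure_duality K)
    (hPT2 : ∀ (K : Type) [Field K] [NumberField K], poitouTate_sha_tateDual K)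
    (hfitt : ∀ (N : ℕ) [NeZero N] (K : Type) [Field K] [NumberField K]
      (Dt : ModularParametrizationData W N)
      (H : HeegnerDatum N (NumberField.discr K)) (ιK : K →+* ℂ) (P : (W.baseChange K).toAffine.Point),
      CellC W p → W.conductorNorm ℤ = N →
      IsImaginaryQuadratic K → NumberField.discr K < -4 → SatisfiesHeegnerHypothesis N K →
      (W.quadraticTwist (NumberField.discr K : ℚ)).entireLFunction 1 ≠ 0 →
      WeierstrassCurve.Affine.Point.map ιK.toRatAlgHom P = heegnerPointComplex Dt H →
      ¬ (p : ℤ) ∣ Dt.c → ¬ IsOfFinAddOrder P →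
      Odd (NumberField.discr K) →
      ∀ (κ : ZpExtension K p), κ.IsAnticyclotomic →
        ∀ (γ : Field.absoluteGaloisGroup K) [Fact (κ.IsTopGenerator γ)]
          (𝔭 : HeightOneSpectrum (𝓞 K)), ((p : ℕ) : 𝓞 K) ∈ 𝔭.asIdeal →
          𝔭.asIdeal.ramificationIdx (𝓞 ℚ) = 1 → 𝔭.asIdeal.inertiaDeg (𝓞 ℚ) = 1 →
          ∀ (𝔭bar : HeightOneSpectrum (𝓞 K)), ((p : ℕ) : 𝓞 K) ∈ 𝔭bar.asIdeal → 𝔭bar ≠ 𝔭 →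
            ((Ideal.span {(p : ℤ)}).primesOver (𝓞 K)).ncard = 2 →
          ∀ (f : CuspForm (CongruenceSubgroup.Gamma0 N) 2), IsNewformOf W f →
            ∀ (ι' : PadicAlgCl p ≃+* ℂ),
              (∀ (w : InfinitePlace K) (k : 𝓞 K),
                k ∈ 𝔭.asIdeal ↔ ‖ι'.symm (w.embedding (k : K))‖ < 1) →
              ∀ (ΩK : ℂ) (Ωp : ℂ_[p]) (Q : PowerSeries 𝓞_ℂ_[p]), ΩK ≠ 0 → ‖Ωp‖ = 1 →
                R1.IsBDPLFunctionInt p ι' 𝔭 κ γ f ΩK Ωp Q →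
                  (Module.fittingIdeal (IwasawaAlgebra p) (XAc (W.baseChange K) p κ 𝔭bar ∅ γ) 0).map
                      (PowerSeries.map (R1.toCpInt p)) ≤ Ideal.span {Q}) :
    HidaLimitRevDivOnTreeIntOther W p := by
  refine hidaLimitRevDivOnTreeIntOther_of_isTorsion_of_map_fittingIdeal_le ?_
  intro N _ K _ _ Dt H ιK P hc hN hK hd4 hHN hLt hP hcM hPinf hodd κ hκ γ _ 𝔭 h𝔭 he hf 𝔭bar h𝔭bar hne
    hsplit f hfW ι' hι' ΩK Ωp Q hΩK hΩp hQ
  refine ⟨?_, hfitt N K Dt H ιK P hc hN hK hd4 hHN hLt hP hcM hPinf hodd κ hκ γ 𝔭 h𝔭 he hf 𝔭bar h𝔭bar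
    hne hsplit f hfW ι' hι' ΩK Ωp Q hΩK hΩp hQ⟩
  have hpN : p ∣ N := hN ▸ Summit.BirchSwinnertonDyer.Rank1Residual.X11b.dvd_conductorNorm_of_mult
    (W := W) hc.2.2.2
  have hsplitK : SatisfiesHeegnerHypothesis p K := fun q hq hqp => hHN q hq (hqp.trans hpN)
  exact isTorsion_xAc_other_of_cellC hGZK hnf hPT hPT2 hc hK hsplitK hLt P hPinf κ hκ γ 𝔭bar h𝔭bar

end RevDivOther

/-! ### §5 The v9 `stub_c3` VERBATIM from PUB facts + Fitting-form reverse divisibility at `𝔭̄` + D′ at `𝔭̄` -/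

section StubC3Other

/-- **`stub_c3` (line b1 v9, crux 4 `BSDpOnCellC`; RE-ORIENTED per RULING L31/L32) FROM [PUB ×4] + [the
reverse divisibility `Fitt_Λ(X_ac^∅ strict at 𝔭̄)·𝓞_{ℂ_p}⟦T⟧ ⊆ (Q)` at every X2c Heegner datum and
every `𝓞_{ℂ_p}`-frame at `(ι′, 𝔭)`] + [KELLER–YIN D′ at `𝔭̄` at each sign].** `hfitt` is stated INLINE
on the binders of `X2.HidaLimitRevDivOnTreeIntOther` (no new `Prop`); `hml` / `hmls` are D′ at `𝔭̄`
(`X2.NonsplitMuLambdaOnTreeIntOther` / `X2.SplitMuLambdaOnTreeIntOther`, p489067, PRE); the torsion of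
`X_ac^∅ strict at 𝔭̄` is discharged at both signs (§3); then §4 and the p489067 glue
`X2.nonsplit/splitIMCEqOnTreeIntOther_of_hidaLimitRevDivIntOther_of_muLambdaIntOther`. Conclusion: the
v9 `stub_c3` signature VERBATIM (cgshw g12 STATUS 02:31:23Z; registered). This is the ONE-LINE kernel
residual of road H for the re-oriented IMC atom: the Skinner–Urban direction in Fitting form for
Keller–Yin's own `𝔛_f`. CONDITIONAL-RESULT (typed ≠ proved ≠ endorsed); nothing booked; no label or
count moves. [claim: KellerYin2024, status: under-review]
[cite: KellerYin2024, §5.1 and Thm. 5.1.3 = Thm. D (arXiv:2402.12781v2 L1725–L1770)]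
[cite: SkinnerUrban2014, §3.1.6 (p. 20)] [cite: Castella2018, Thm. 2.3 (arXiv:1704.06608 p. 5)] -/
theorem stub_c3_of_fittingRevDivIntOther_of_muLambdaIntOther
    (hGZK : rank_eq_analyticRank_of_analyticRank_le_one) (hnf : exists_isNewformOf)
    (hPT : ∀ (K : Type) [Field K] [NumberField K], poitouTate_selmerStructure_duality K)
    (hPT2 : ∀ (K : Type) [Field K] [NumberField K], poitouTate_sha_tateDual K)
    (hfitt : ∀ (W : WeierstrassCurve ℚ) [W.IsElliptic] [W.IsGloballyMinimal] (p : ℕ) [Fact p.Prime],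
      CellC W p →
      ∀ (N : ℕ) [NeZero N] (K : Type) [Field K] [NumberField K] (Dt : ModularParametrizationData W N)
        (H : HeegnerDatum N (NumberField.discr K)) (ιK : K →+* ℂ) (P : (W.baseChange K).toAffine.Point),
        CellC W p → W.conductorNorm ℤ = N →
        IsImaginaryQuadratic K → NumberField.discr K < -4 → SatisfiesHeegnerHypothesis N K →
        (W.quadraticTwist (NumberField.discr K : ℚ)).entireLFunction 1 ≠ 0 →
        WeierstrassCurve.Affine.Point.map ιK.toRatAlgHom P = heegnerPointComplex Dt H →
        ¬ (p : ℤ) ∣ Dt.c → ¬ IsOfFinAddOrder P →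
        Odd (NumberField.discr K) →
        ∀ (κ : ZpExtension K p), κ.IsAnticyclotomic →
          ∀ (γ : Field.absoluteGaloisGroup K) [Fact (κ.IsTopGenerator γ)]
            (𝔭 : HeightOneSpectrum (𝓞 K)), ((p : ℕ) : 𝓞 K) ∈ 𝔭.asIdeal →
            𝔭.asIdeal.ramificationIdx (𝓞 ℚ) = 1 → 𝔭.asIdeal.inertiaDeg (𝓞 ℚ) = 1 →
            ∀ (𝔭bar : HeightOneSpectrum (𝓞 K)), ((p : ℕ) : 𝓞 K) ∈ 𝔭bar.asIdeal → 𝔭bar ≠ 𝔭 →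
              ((Ideal.span {(p : ℤ)}).primesOver (𝓞 K)).ncard = 2 →
            ∀ (f : CuspForm (CongruenceSubgroup.Gamma0 N) 2), IsNewformOf W f →
              ∀ (ι' : PadicAlgCl p ≃+* ℂ),
                (∀ (w : InfinitePlace K) (k : 𝓞 K),
                  k ∈ 𝔭.asIdeal ↔ ‖ι'.symm (w.embedding (k : K))‖ < 1) →
                ∀ (ΩK : ℂ) (Ωp : ℂ_[p]) (Q : PowerSeries 𝓞_ℂ_[p]), ΩK ≠ 0 → ‖Ωp‖ = 1 →
                  R1.IsBDPLFunctionInt p ι' 𝔭 κ γ f ΩK Ωp Q →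
                    (Module.fittingIdeal (IwasawaAlgebra p) (XAc (W.baseChange K) p κ 𝔭bar ∅ γ) 0).map
                        (PowerSeries.map (R1.toCpInt p)) ≤ Ideal.span {Q})
    (hml : ∀ (W : WeierstrassCurve ℚ) [W.IsElliptic] [W.IsGloballyMinimal] (p : ℕ) [Fact p.Prime],
      CellC W p → ¬ W.HasSplitMultiplicativeReductionAtPrime p → NonsplitMuLambdaOnTreeIntOther W p)
    (hmls : ∀ (W : WeierstrassCurve ℚ) [W.IsElliptic] [W.IsGloballyMinimal] (p : ℕ) [Fact p.Prime],
      CellC W p → W.HasSplitMultiplicativeReductionAtPrime p → SplitMuLambdaOnTreeIntOther W p) :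
    (∀ (W : WeierstrassCurve ℚ) [W.IsElliptic] [W.IsGloballyMinimal] (p : ℕ) [Fact p.Prime],
      CellC W p → ¬ W.HasSplitMultiplicativeReductionAtPrime p → NonsplitIMCEqOnTreeIntOther W p) ∧
    (∀ (W : WeierstrassCurve ℚ) [W.IsElliptic] [W.IsGloballyMinimal] (p : ℕ) [Fact p.Prime],
      CellC W p → W.HasSplitMultiplicativeReductionAtPrime p → SplitIMCEqOnTreeIntOther W p) := by
  have hrev : ∀ (W : WeierstrassCurve ℚ) [W.IsElliptic] [W.IsGloballyMinimal] (p : ℕ) [Fact p.Prime],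
      CellC W p → HidaLimitRevDivOnTreeIntOther W p := fun W _ _ p _ hc ↦
    hidaLimitRevDivOnTreeIntOther_of_map_fittingIdeal_le hGZK hnf hPT hPT2 (hfitt W p hc)
  exact ⟨fun W _ _ p _ hc hns ↦
      nonsplitIMCEqOnTreeIntOther_of_hidaLimitRevDivIntOther_of_muLambdaIntOther (hrev W p hc)
        (hml W p hc hns),
    fun W _ _ p _ hc hs ↦
      splitIMCEqOnTreeIntOther_of_hidaLimitRevDivIntOther_of_muLambdaIntOther (hrev W p hc)
        (hmls W p hc hs)⟩

end StubC3Other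

end Summit.BirchSwinnertonDyer.BirchSwinnertonDyer.Theorems

end
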